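import Summits.QuantumFields.BalabanUV.Beta.GAN24.DirichletBoxTwoLevelCore

/-!
# `BalabanUV.Beta.GAN24.DirichletBoxWeightedSockets` — binder row G-an2-4 / (CONV-C), road P2 PART IV, module M-W: THE WEIGHTED SOCKET —
# the two-level injected law of the Ω-compressed `U = 1` scalar free tower for an ARBITRARY coarse region, CONDITIONAL on WEIGHTED
# ONE-LEVEL binders (unit b2b-balaban-gan24-p2, gen 24, v1.1 — docstrings only: «sibling of (S2)» wording per referees ref1 R126 / ref2 R129-1)

HONEST FRAMING (cell contract, verbatim): «discharging `BetaPertH` makes Bałaban's UV stability UNCONDITIONAL — a real constructive-QFT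
result; it is NOT the continuum limit and NOT the Clay problem.»  SUPPLIER module under the T⁴-DAG sub-row `T4-U1a.S-NE2-D1-DIRICHLET°`
(holder: the t4-ne2-p1 lineage; owner wording R24 «the full rate L⁻¹ beyond boxes OPEN»).  Objects as in road P2 PART II/III: the `U = 1`
SCALAR layer `Δ′ = DeltaPs n M a′` ([Balaban1985BackgroundPropagators] (3.24) p. 394 at `U = 1`) compressed to a coarse region `Ω`
(module M-C `DOm`, zero outside, boundary = first exterior layer), King's planting `J₀ = JK0 N R M` compressed to `J^Ω = (J₀)_{Ω′Ω}` (`JOm`),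
`Ω′ = par⁻¹Ω` (`refineR`).

WHY WEIGHTS (the re-cut of the located wall W-S2 / W-full of GAPS § C-gan24p2-23).  Module M-P's pairing identity
`⟨v,(J₀Δ − Δ′J₀)u⟩ = Σ_μ ⟨(A_μ − F_μ)v, ∂_μu⟩` pairs, face by face, a window moment of the fine second differences `∂′ᴴ_μ∂′_μv` with ONE
coarse difference `∂_μu`, at the price `1/N` (M-PB `cWin`).  Module M-E closed it by an UNWEIGHTED Cauchy–Schwarz, whose fine factor — the
interior Hessian budget — grows like `n^{2/3}` at a re-entrant edge (gen 23 numerics, kit j103643), although the face sum itself converges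
absolutely there (`|∂′ᴴ∂′v| ~ r^{−4/3}`, `|∂u| ~ r^{−1/3}`, `Σ r^{−5/3}·r < ∞`).  This module replaces that one step by a WEIGHTED
Cauchy–Schwarz with an arbitrary pair of weights — a coarse weight `ω > 0` and a fine weight `w′ ≥ 0` dominating `ω` on the windows — and
leaves the boundary (flux) part unweighted:

 * §1 **`window_cs_weighted`**: `Σ_y ‖cWin·winSum g y‖·‖b y‖ ≤ (2/N)·√(Σ_x w′(x)‖g x‖²)·√(Σ_y ω(y)⁻¹‖b y‖²)` (M-E file 1 §2 with weights;
   each fine site lies in ≤ 2 windows, M-PB `sum_window_le`).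
 * §2 **`pairing_dir_le_weighted`** — for ANY decidable coarse region `Ω`, `u` vanishing off `Ω`, ANY fine field `v`:
   `|⟨(A_μ − F_μ)v, ∂_μu⟩| ≤ (2/N)·[√(Σ_{x∈Ω′} w′|∂′ᴴ_μ∂′_μv|²)·√(Σ_y ω⁻¹|∂_μu|²) + √(Σ_{x∉Ω′}|∂′ᴴ_μ∂′_μv|²)·√(nsq(bdryPart ∂_μu))]`;
   §3 **`pairing_le_weighted`**: the sum over `μ` with the four sums under the square roots.
 * §4 **THE WEIGHTED SOCKET `injected_le_of_weighted`**: for ANY decidable coarse region `Ω` and weights as above, FOUR displayed one-level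
   binders on the zero-extended Dirichlet solutions — (A′) weighted interior Hessian of the fine solution `≤ α′‖w‖²`, (B) inverse-weighted
   energy of the coarse solution `≤ β‖f‖²`, (Φ′) exterior second-difference density of the fine solution `≤ φ′‖w‖²` (= `(RN)²`× its boundary
   flux), (Φ) boundary part of the coarse differences `≤ φ‖f‖²` — give
   `‖(D′^{Ω′})⁻¹·J^Ω − J^Ω·(D^Ω)⁻¹‖ ≤ (2/N)·(√α′·√β + √φ′·√φ)`.
   A SIBLING of the budget socket (S2) of M-S, not a re-cut of it (referees gan24-formalise-ref1 R126 / ref2 R129-1): with `ω ≡ w′ ≡ 1`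
   the binders (A′), (B) are summands of (S2)'s budgets, but the flux part is displayed separately as (Φ′), (Φ) instead of being absorbed
   by M-T's fixed-length traces, and `Ω` is an arbitrary decidable region — the two ENDs coincide only up to constants and this split.
   With `ω = w′∘(coarse face) =` distance to the re-entrant codimension-2 set (floored at the lattice scale) all four binders are
   EXPECTED `N`-uniform on every union of unit blocks
   (`α′, β = O(1)`, `φ′ = O(RN)`, `φ = O(1/N)`; numerics `HOME/b2b-balaban-gan24-p2/gen24/numerics/`) ⇒ the full rate `1/N`.
   What remains for a supplier is ONE-LEVEL weighted regularity (energy decay with exponent `> 1` in the 2-D cross-section of a re-entrant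
   edge + localized M-R), no two-level argument.

ABSOLUTE RULE (cell, verbatim): «No internally-minted statement may enter as a cited fact. Every hypothesis is either kernel-proved in
this package or a verbatim quotation of a PUBLISHED theorem with page reference. The manuscript(s) under audit are NOT citable for
their own disputed steps — they are the thing under adjudication; programme-internal (2001/route/tribunal) claims are never citable.»
[folklore] finite lattice calculus on the tree's typed `U = 1` objects; nothing printed is a hypothesis; the four binders are DISPLAYED
hypotheses, not facts.  NOT CLAIMED: the binders themselves, the vector layer (`calDalev`), NE2, (CONV-C) as a whole, `BetaPertH`,
continuum, Clay.  «not in print; our proof attempt».  HONEST DEPENDENCY: continuum YM on T⁴ ⇐ BetaPertH ∧ nine spine estimates (0/9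
proved); BetaPertH ⇐ (D1) ∧ (D4) ∧ CAP+tail; G-an2-4 gates asym, D1 and NE2/3/4.
-/

noncomputable section

open scoped BigOperators ComplexConjugate Matrix Matrix.Norms.L2Operator
open Finset Polynomial

namespace Summit.QuantumFields.BalabanUV.Beta.GAN24.DirichletBoxWeightedSockets

open Literature.MathematicalPhysics.QuantumFieldTheory.Balaban1983to89.B5Prop11Plancherel (Tor fine unitVec)
open Literature.MathematicalPhysics.QuantumFieldTheory.Balaban1983to89.B5Action121 (sdiff LapS sdiff_mulVec
  dotProduct_mulVec_eq_star_conjTranspose_mulVec)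
open Literature.MathematicalPhysics.QuantumFieldTheory.Balaban1983to89.B5Prop11Lower (nsq nsq_nonneg)
open Literature.MathematicalPhysics.QuantumFieldTheory.Balaban1983to89.B5Block118 (tstep)
open Literature.MathematicalPhysics.QuantumFieldTheory.Balaban1983to89.B5G183RateTorus (cpt)
open Literature.MathematicalPhysics.QuantumFieldTheory.Balaban1983to89.B5G183RateTorusW (off)
open Summit.QuantumFields.BalabanUV.T4Continuum
open Summit.QuantumFields.BalabanUV.T4Continuum.ScalarBlockPlanting (JK0)
open Summit.QuantumFields.BalabanUV.T4Continuum.ScalarAveragedPropagator (gammaPs gammaPs_pos)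
open Summit.QuantumFields.BalabanUV.Beta.GAN24.DirichletBoxRegularity (Pdir)
open Summit.QuantumFields.BalabanUV.Beta.GAN24.DirichletBoxPairing (Aop Fop pairing_identity cWin norm_cWin_mul_sq
  card_firstLayer_mul sum_window_le)
open Summit.QuantumFields.BalabanUV.Beta.GAN24.DirichletBoxCompression (DOm JOm solExt refineR solExt_apply_of_not form_defect
  opNorm_le_of_pairing)
open Summit.QuantumFields.BalabanUV.Beta.GAN24.DirichletBoxTwoLevelCore (site winSum norm_cWin_winSum_le window_cs
  Aop_sub_Fop_mulVec_split nsq_interior_density bdryPart exterior_pairs_bdry)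

variable {d : ℕ} (N R : ℕ) [NeZero N] [NeZero R] (M : Fin d → ℕ) [hM : ∀ μ, NeZero (M μ)]

/-! ## §1 The weighted window Cauchy–Schwarz -/

/-- **THE WEIGHTED WINDOW CAUCHY–SCHWARZ**: for every density `g` on `T′`, every `b` on `T`, every coarse weight `ω > 0` and fine weight
`w′ ≥ 0` with `ω(y) ≤ w′(x)` for `x` in the `μ`-window of `y`,
`Σ_y ‖cWin·winSum g y‖·‖b y‖ ≤ (2/N)·√(Σ_x w′(x)‖g x‖²)·√(Σ_y ω(y)⁻¹‖b y‖²)`. [folklore] -/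
theorem window_cs_weighted (μ : Fin d) (g : Tor (fine (R * N) M) → ℂ) (b : Tor (fine N M) → ℂ)
    {ω : Tor (fine N M) → ℝ} {w' : Tor (fine (R * N) M) → ℝ} (hω : ∀ y, 0 < ω y) (hw' : ∀ x, 0 ≤ w' x)
    (hcomp : ∀ (y : Tor (fine N M)) (j : Fin d → Fin R), (j μ : ℕ) = 0 → ∀ n, n < 2 * R - 2 →
      ω y ≤ w' (site N R M μ y j (n + 1))) :
    ∑ y, ‖cWin d N R * winSum N R M μ g y‖ * ‖b y‖
      ≤ 2 / (N : ℝ) * (Real.sqrt (∑ x, w' x * ‖g x‖ ^ 2) * Real.sqrt (∑ y, (ω y)⁻¹ * ‖b y‖ ^ 2)) := by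
  have hRpos : (0 : ℝ) < R := by exact_mod_cast Nat.pos_of_ne_zero (NeZero.ne R)
  have hNpos : (0 : ℝ) < N := by exact_mod_cast Nat.pos_of_ne_zero (NeZero.ne N)
  have hRd : (0 : ℝ) < (R : ℝ) ^ d := pow_pos hRpos d
  set F : Finset (Fin d → Fin R) := univ.filter (fun j : Fin d → Fin R => (j μ : ℕ) = 0) with hF
  set WG : ℝ := ∑ x, w' x * ‖g x‖ ^ 2 with hWG
  set WB : ℝ := ∑ y, (ω y)⁻¹ * ‖b y‖ ^ 2 with hWB
  have hWG0 : 0 ≤ WG := Finset.sum_nonneg fun x _ => mul_nonneg (hw' x) (sq_nonneg _)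
  have hWB0 : 0 ≤ WB := Finset.sum_nonneg fun y _ => mul_nonneg (inv_pos.mpr (hω y)).le (sq_nonneg _)
  -- the pointwise window bound of M-E file 1
  have h2 : ∑ y, ‖cWin d N R * winSum N R M μ g y‖ * ‖b y‖ ≤ ((N : ℝ) * Real.sqrt ((R : ℝ) ^ d))⁻¹ *
      ∑ y, ∑ j ∈ F, ∑ n ∈ range (2 * R - 2), ‖g (site N R M μ y j (n + 1))‖ * ‖b y‖ := by
    rw [Finset.mul_sum]
    refine Finset.sum_le_sum fun y _ => ?_
    calc ‖cWin d N R * winSum N R M μ g y‖ * ‖b y‖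
        ≤ (((N : ℝ) * Real.sqrt ((R : ℝ) ^ d))⁻¹ * ∑ j ∈ F, ∑ n ∈ range (2 * R - 2), ‖g (site N R M μ y j (n + 1))‖) * ‖b y‖ :=
          mul_le_mul_of_nonneg_right (norm_cWin_winSum_le N R M μ g y) (norm_nonneg _)
      _ = _ := by rw [mul_assoc, Finset.sum_mul]; congr 1; refine Finset.sum_congr rfl fun j _ => ?_; rw [Finset.sum_mul]
  -- the WEIGHTED Cauchy–Schwarz on the triple sum: insert `√ω(y)·(√ω(y))⁻¹ = 1`
  have hrw : ∀ (y : Tor (fine N M)) (j : Fin d → Fin R) (n : ℕ), ‖g (site N R M μ y j (n + 1))‖ * ‖b y‖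
      = (Real.sqrt (ω y) * ‖g (site N R M μ y j (n + 1))‖) * ((Real.sqrt (ω y))⁻¹ * ‖b y‖) := by
    intro y j n
    have hs : Real.sqrt (ω y) ≠ 0 := (Real.sqrt_pos.mpr (hω y)).ne'
    field_simp
  have h3 : ∑ y, ∑ j ∈ F, ∑ n ∈ range (2 * R - 2), ‖g (site N R M μ y j (n + 1))‖ * ‖b y‖
      ≤ Real.sqrt (2 * WG) * Real.sqrt (2 * (R : ℝ) ^ d * WB) := by
    simp only [hrw]
    rw [← Finset.sum_product', ← Finset.sum_product']
    refine (Real.sum_mul_le_sqrt_mul_sqrt _ _ _).trans ?_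
    refine mul_le_mul (Real.sqrt_le_sqrt ?_) (Real.sqrt_le_sqrt ?_) (Real.sqrt_nonneg _) (Real.sqrt_nonneg _)
    · rw [Finset.sum_product, Finset.sum_product]
      calc ∑ y, ∑ j ∈ F, ∑ n ∈ range (2 * R - 2), (Real.sqrt (ω y) * ‖g (site N R M μ y j (n + 1))‖) ^ 2
          ≤ ∑ y, ∑ j ∈ F, ∑ n ∈ range (2 * R - 2), w' (site N R M μ y j (n + 1)) * ‖g (site N R M μ y j (n + 1))‖ ^ 2 := by
            refine Finset.sum_le_sum fun y _ => Finset.sum_le_sum fun j hj => Finset.sum_le_sum fun n hn => ?_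
            have hj' : (j μ : ℕ) = 0 := by rw [hF] at hj; exact (Finset.mem_filter.mp hj).2
            have hn' : n < 2 * R - 2 := Finset.mem_range.mp hn
            rw [mul_pow, Real.sq_sqrt (hω y).le]
            exact mul_le_mul_of_nonneg_right (hcomp y j hj' n hn') (sq_nonneg _)
        _ ≤ 2 * WG := by
            have hw := sum_window_le N R M μ (g := fun x => w' x * ‖g x‖ ^ 2) (fun x => mul_nonneg (hw' x) (sq_nonneg _))
            rw [hF]
            exact hw
    · rw [Finset.sum_product, Finset.sum_product]
      have hterm : ∀ y, ((Real.sqrt (ω y))⁻¹ * ‖b y‖) ^ 2 = (ω y)⁻¹ * ‖b y‖ ^ 2 := by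
        intro y; rw [mul_pow, inv_pow, Real.sq_sqrt (hω y).le]
      simp only [hterm, Finset.sum_const, Finset.card_range, nsmul_eq_mul]
      rw [← Finset.mul_sum, ← Finset.mul_sum]
      have hcard := card_firstLayer_mul R (d := d) μ
      rw [← hF] at hcard
      have hR2 : ((2 * R - 2 : ℕ) : ℝ) ≤ 2 * R := by
        have : 2 * R - 2 ≤ 2 * R := Nat.sub_le _ _
        exact_mod_cast this
      calc (F.card : ℝ) * (((2 * R - 2 : ℕ) : ℝ) * WB) ≤ (F.card : ℝ) * ((2 * R) * WB) := by
            refine mul_le_mul_of_nonneg_left (mul_le_mul_of_nonneg_right hR2 hWB0) (Nat.cast_nonneg _)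
        _ = 2 * ((F.card : ℝ) * R) * WB := by ring
        _ = 2 * (R : ℝ) ^ d * WB := by rw [hcard]
  have h4 : ((N : ℝ) * Real.sqrt ((R : ℝ) ^ d))⁻¹ * (Real.sqrt (2 * WG) * Real.sqrt (2 * (R : ℝ) ^ d * WB))
      = 2 / (N : ℝ) * (Real.sqrt WG * Real.sqrt WB) := by
    rw [Real.sqrt_mul (by norm_num : (0 : ℝ) ≤ 2) WG, Real.sqrt_mul (by positivity : (0 : ℝ) ≤ 2 * (R : ℝ) ^ d) WB,
      Real.sqrt_mul (by norm_num : (0 : ℝ) ≤ 2) ((R : ℝ) ^ d)]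
    have h2s : Real.sqrt 2 * Real.sqrt 2 = 2 := Real.mul_self_sqrt (by norm_num)
    have hsN : Real.sqrt ((R : ℝ) ^ d) * ((N : ℝ) * Real.sqrt ((R : ℝ) ^ d))⁻¹ = (N : ℝ)⁻¹ := by
      have hsq : 0 < Real.sqrt ((R : ℝ) ^ d) := Real.sqrt_pos.mpr hRd
      field_simp
    calc ((N : ℝ) * Real.sqrt ((R : ℝ) ^ d))⁻¹ * (Real.sqrt 2 * Real.sqrt WG
          * (Real.sqrt 2 * Real.sqrt ((R : ℝ) ^ d) * Real.sqrt WB))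
        = (Real.sqrt 2 * Real.sqrt 2) * (Real.sqrt ((R : ℝ) ^ d) * ((N : ℝ) * Real.sqrt ((R : ℝ) ^ d))⁻¹)
          * (Real.sqrt WG * Real.sqrt WB) := by ring
      _ = 2 / (N : ℝ) * (Real.sqrt WG * Real.sqrt WB) := by rw [h2s, hsN, div_eq_mul_inv]
  calc _ ≤ _ := h2
    _ ≤ ((N : ℝ) * Real.sqrt ((R : ℝ) ^ d))⁻¹ * (Real.sqrt (2 * WG) * Real.sqrt (2 * (R : ℝ) ^ d * WB)) :=
        mul_le_mul_of_nonneg_left h3 (by positivity)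
    _ = _ := h4

/-! ## §2 The weighted per-direction estimate (any decidable coarse region, any fine field) -/

variable (Ω : Tor (fine N M) → Prop) [DecidablePred Ω]

/-- the weighted interior density: `Σ_x w′(x)‖𝟙_{Ω′}(x)(∂′ᴴ∂′v)(x)‖² = Σ_{x ∈ Ω′} w′(x)‖(∂′ᴴ∂′v)(x)‖²`. [folklore] -/
theorem sum_weight_interior_density (μ : Fin d) (v : Tor (fine (R * N) M) → ℂ) (w' : Tor (fine (R * N) M) → ℝ) :
    ∑ x, w' x * ‖(if refineR N R M Ω x then (Pdir (fine (R * N) M) ((R * N : ℕ) : ℂ) μ *ᵥ v) x else 0)‖ ^ 2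
      = ∑ x ∈ univ.filter (refineR N R M Ω), w' x * ‖(Pdir (fine (R * N) M) ((R * N : ℕ) : ℂ) μ *ᵥ v) x‖ ^ 2 := by
  rw [Finset.sum_filter]
  refine Finset.sum_congr rfl fun x _ => ?_
  split_ifs <;> simp

/-- the exterior density has `nsq = Σ_{x ∉ Ω′} ‖(∂′ᴴ∂′v)(x)‖²`. [folklore] -/
theorem nsq_exterior_density (μ : Fin d) (v : Tor (fine (R * N) M) → ℂ) :
    nsq (fun x => if refineR N R M Ω x then 0 else (Pdir (fine (R * N) M) ((R * N : ℕ) : ℂ) μ *ᵥ v) x)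
      = ∑ x ∈ univ.filter (fun x => ¬ refineR N R M Ω x), ‖(Pdir (fine (R * N) M) ((R * N : ℕ) : ℂ) μ *ᵥ v) x‖ ^ 2 := by
  rw [nsq, Finset.sum_filter]
  refine Finset.sum_congr rfl fun x _ => ?_
  split_ifs <;> simp

/-- **THE WEIGHTED PER-DIRECTION ESTIMATE**: for ANY decidable coarse region `Ω` (fine region `Ω′ = par⁻¹Ω`), `u` vanishing off `Ω`, ANY fine
field `v`, and weights `ω > 0` (coarse), `w′ ≥ 0` (fine) with `ω ≤ w′` on the `μ`-windows:
`|⟨(A_μ − F_μ)v, ∂_μu⟩| ≤ (2/N)·[√(Σ_{x∈Ω′} w′(x)|(∂′ᴴ_μ∂′_μv)(x)|²)·√(Σ_y ω(y)⁻¹|(∂_μu)(y)|²)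
                            + √(Σ_{x∉Ω′}|(∂′ᴴ_μ∂′_μv)(x)|²)·√(nsq(bdryPart (∂_μu)))]`
— the interior part by the WEIGHTED window Cauchy–Schwarz, the exterior (flux) part unweighted (M-E file 1 §2–§4). [folklore] -/
theorem pairing_dir_le_weighted (μ : Fin d) {u : Tor (fine N M) → ℂ} (hu : ∀ y, ¬ Ω y → u y = 0) (v : Tor (fine (R * N) M) → ℂ)
    {ω : Tor (fine N M) → ℝ} {w' : Tor (fine (R * N) M) → ℝ} (hω : ∀ y, 0 < ω y) (hw' : ∀ x, 0 ≤ w' x)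
    (hcomp : ∀ (y : Tor (fine N M)) (j : Fin d → Fin R), (j μ : ℕ) = 0 → ∀ n, n < 2 * R - 2 →
      ω y ≤ w' (site N R M μ y j (n + 1))) :
    ‖star ((Aop N R M μ - Fop N R M μ) *ᵥ v) ⬝ᵥ (sdiff (fine N M) (N : ℂ) μ *ᵥ u)‖
      ≤ 2 / (N : ℝ) *
        (Real.sqrt (∑ x ∈ univ.filter (refineR N R M Ω), w' x * ‖(Pdir (fine (R * N) M) ((R * N : ℕ) : ℂ) μ *ᵥ v) x‖ ^ 2)
            * Real.sqrt (∑ y, (ω y)⁻¹ * ‖(sdiff (fine N M) (N : ℂ) μ *ᵥ u) y‖ ^ 2)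
          + Real.sqrt (∑ x ∈ univ.filter (fun x => ¬ refineR N R M Ω x), ‖(Pdir (fine (R * N) M) ((R * N : ℕ) : ℂ) μ *ᵥ v) x‖ ^ 2)
            * Real.sqrt (nsq (bdryPart N M Ω μ (sdiff (fine N M) (N : ℂ) μ *ᵥ u)))) := by
  have hNpos : (0 : ℝ) < N := by exact_mod_cast Nat.pos_of_ne_zero (NeZero.ne N)
  set P' := Pdir (fine (R * N) M) ((R * N : ℕ) : ℂ) μ with hP'
  set a := (Aop N R M μ - Fop N R M μ) *ᵥ v with ha
  set b := sdiff (fine N M) (N : ℂ) μ *ᵥ u with hb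
  set gI : Tor (fine (R * N) M) → ℂ := fun x => if refineR N R M Ω x then (P' *ᵥ v) x else 0 with hgI
  set gE : Tor (fine (R * N) M) → ℂ := fun x => if refineR N R M Ω x then 0 else (P' *ᵥ v) x with hgE
  -- `|⟨a,b⟩| ≤ Σ ‖a‖‖b‖ ≤ Σ ‖aI‖‖b‖ + Σ ‖aE‖‖bdry b‖`
  have h1 : ‖star a ⬝ᵥ b‖ ≤ ∑ y, ‖a y‖ * ‖b y‖ := by
    refine (norm_sum_le _ _).trans (Finset.sum_le_sum fun y _ => ?_)
    rw [Pi.star_apply, norm_mul, norm_star]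
  have h2 : ∑ y, ‖a y‖ * ‖b y‖ ≤ ∑ y, ‖cWin d N R * winSum N R M μ gI y‖ * ‖b y‖
      + ∑ y, ‖cWin d N R * winSum N R M μ gE y‖ * ‖bdryPart N M Ω μ b y‖ := by
    rw [← Finset.sum_add_distrib]
    refine Finset.sum_le_sum fun y _ => ?_
    rw [← exterior_pairs_bdry N R M Ω μ v hu y, ← add_mul]
    refine mul_le_mul_of_nonneg_right ?_ (norm_nonneg _)
    rw [ha, Aop_sub_Fop_mulVec_split N R M Ω μ v y]
    exact norm_add_le _ _
  -- interior part: WEIGHTED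
  have hI : ∑ y, ‖cWin d N R * winSum N R M μ gI y‖ * ‖b y‖
      ≤ 2 / (N : ℝ) * (Real.sqrt (∑ x ∈ univ.filter (refineR N R M Ω), w' x * ‖(P' *ᵥ v) x‖ ^ 2)
          * Real.sqrt (∑ y, (ω y)⁻¹ * ‖b y‖ ^ 2)) := by
    rw [← sum_weight_interior_density N R M Ω μ v w']
    exact window_cs_weighted N R M μ gI b hω hw' hcomp
  -- exterior part: unweighted
  have hE : ∑ y, ‖cWin d N R * winSum N R M μ gE y‖ * ‖bdryPart N M Ω μ b y‖
      ≤ 2 / (N : ℝ) * (Real.sqrt (∑ x ∈ univ.filter (fun x => ¬ refineR N R M Ω x), ‖(P' *ᵥ v) x‖ ^ 2)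
          * Real.sqrt (nsq (bdryPart N M Ω μ b))) := by
    rw [← nsq_exterior_density N R M Ω μ v]
    exact window_cs N R M μ gE _
  calc ‖star a ⬝ᵥ b‖ ≤ _ := h1
    _ ≤ _ := h2
    _ ≤ _ := add_le_add hI hE
    _ = _ := by rw [← mul_add]

/-! ## §3 The summed weighted pairing estimate -/

/-- **THE SUMMED WEIGHTED PAIRING ESTIMATE**: for ANY decidable coarse region `Ω`, `u` vanishing off `Ω`, ANY fine field `v`, and weights
`ω > 0`, `w′ ≥ 0` with `ω ≤ w′` on every window,
`|⟨v, (J₀Δ_N − Δ_{RN}J₀)u⟩| ≤ (2/N)·[√(Σ_μ Σ_{x∈Ω′} w′|∂′ᴴ_μ∂′_μv|²)·√(Σ_μ Σ_y ω⁻¹|∂_μu|²) + √(Σ_μ Σ_{x∉Ω′}|∂′ᴴ_μ∂′_μv|²)·√(Σ_μ nsq(bdryPart ∂_μu))]`.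
[folklore] -/
theorem pairing_le_weighted (hN : 1 ≤ N) {u : Tor (fine N M) → ℂ} (hu : ∀ y, ¬ Ω y → u y = 0) (v : Tor (fine (R * N) M) → ℂ)
    {ω : Tor (fine N M) → ℝ} {w' : Tor (fine (R * N) M) → ℝ} (hω : ∀ y, 0 < ω y) (hw' : ∀ x, 0 ≤ w' x)
    (hcomp : ∀ (μ : Fin d) (y : Tor (fine N M)) (j : Fin d → Fin R), (j μ : ℕ) = 0 → ∀ n, n < 2 * R - 2 →
      ω y ≤ w' (site N R M μ y j (n + 1))) :
    ‖star v ⬝ᵥ ((JK0 N R M * LapS (fine N M) (N : ℂ) - LapS (fine (R * N) M) ((R * N : ℕ) : ℂ) * JK0 N R M) *ᵥ u)‖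
      ≤ 2 / (N : ℝ) *
        (Real.sqrt (∑ μ, ∑ x ∈ univ.filter (refineR N R M Ω), w' x * ‖(Pdir (fine (R * N) M) ((R * N : ℕ) : ℂ) μ *ᵥ v) x‖ ^ 2)
            * Real.sqrt (∑ μ, ∑ y, (ω y)⁻¹ * ‖(sdiff (fine N M) (N : ℂ) μ *ᵥ u) y‖ ^ 2)
          + Real.sqrt (∑ μ, ∑ x ∈ univ.filter (fun x => ¬ refineR N R M Ω x), ‖(Pdir (fine (R * N) M) ((R * N : ℕ) : ℂ) μ *ᵥ v) x‖ ^ 2)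
            * Real.sqrt (∑ μ, nsq (bdryPart N M Ω μ (sdiff (fine N M) (N : ℂ) μ *ᵥ u)))) := by
  have hNpos : (0 : ℝ) < N := by exact_mod_cast Nat.pos_of_ne_zero (NeZero.ne N)
  -- the four families of nonnegative per-direction quantities
  set A : Fin d → ℝ := fun μ => ∑ x ∈ univ.filter (refineR N R M Ω), w' x * ‖(Pdir (fine (R * N) M) ((R * N : ℕ) : ℂ) μ *ᵥ v) x‖ ^ 2
    with hA
  set B : Fin d → ℝ := fun μ => ∑ y, (ω y)⁻¹ * ‖(sdiff (fine N M) (N : ℂ) μ *ᵥ u) y‖ ^ 2 with hB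
  set E : Fin d → ℝ := fun μ => ∑ x ∈ univ.filter (fun x => ¬ refineR N R M Ω x),
    ‖(Pdir (fine (R * N) M) ((R * N : ℕ) : ℂ) μ *ᵥ v) x‖ ^ 2 with hE
  set T : Fin d → ℝ := fun μ => nsq (bdryPart N M Ω μ (sdiff (fine N M) (N : ℂ) μ *ᵥ u)) with hT
  have hA0 : ∀ μ, 0 ≤ A μ := fun μ => Finset.sum_nonneg fun x _ => mul_nonneg (hw' x) (sq_nonneg _)
  have hB0 : ∀ μ, 0 ≤ B μ := fun μ => Finset.sum_nonneg fun y _ => mul_nonneg (inv_pos.mpr (hω y)).le (sq_nonneg _)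
  have hE0 : ∀ μ, 0 ≤ E μ := fun μ => Finset.sum_nonneg fun x _ => sq_nonneg _
  have hT0 : ∀ μ, 0 ≤ T μ := fun μ => nsq_nonneg _
  rw [pairing_identity N R M hN, Matrix.sum_mulVec, dotProduct_sum]
  refine (norm_sum_le _ _).trans ?_
  have hpair : ∀ μ, star v ⬝ᵥ (((Aop N R M μ - Fop N R M μ)ᴴ * sdiff (fine N M) (N : ℂ) μ) *ᵥ u)
      = star ((Aop N R M μ - Fop N R M μ) *ᵥ v) ⬝ᵥ (sdiff (fine N M) (N : ℂ) μ *ᵥ u) := by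
    intro μ
    rw [← Matrix.mulVec_mulVec, dotProduct_mulVec_eq_star_conjTranspose_mulVec, Matrix.conjTranspose_conjTranspose]
  calc ∑ μ, ‖star v ⬝ᵥ (((Aop N R M μ - Fop N R M μ)ᴴ * sdiff (fine N M) (N : ℂ) μ) *ᵥ u)‖
      ≤ ∑ μ, 2 / (N : ℝ) * (Real.sqrt (A μ) * Real.sqrt (B μ) + Real.sqrt (E μ) * Real.sqrt (T μ)) :=
        Finset.sum_le_sum fun μ _ => by rw [hpair μ]; exact pairing_dir_le_weighted N R M Ω μ hu v hω hw' (hcomp μ)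
    _ = 2 / (N : ℝ) * (∑ μ, Real.sqrt (A μ) * Real.sqrt (B μ) + ∑ μ, Real.sqrt (E μ) * Real.sqrt (T μ)) := by
        rw [← Finset.sum_add_distrib, ← Finset.mul_sum]
    _ ≤ 2 / (N : ℝ) * (Real.sqrt (∑ μ, A μ) * Real.sqrt (∑ μ, B μ) + Real.sqrt (∑ μ, E μ) * Real.sqrt (∑ μ, T μ)) :=
        mul_le_mul_of_nonneg_left (add_le_add (Real.sum_sqrt_mul_sqrt_le _ hA0 hB0) (Real.sum_sqrt_mul_sqrt_le _ hE0 hT0))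
          (div_nonneg zero_le_two hNpos.le)

/-! ## §4 THE WEIGHTED SOCKET -/

variable (a' : ℝ)

/-- **THE WEIGHTED SOCKET** — the two-level injected law of the Ω-compressed `U = 1` scalar free tower for an ARBITRARY decidable coarse
region `Ω` (fine region `Ω′ = par⁻¹Ω`), CONDITIONAL on FOUR displayed ONE-LEVEL binders on the zero-extended Dirichlet solutions
`u_f = solExt_N f ⊂ Ω`, `v_w = solExt_{RN} w ⊂ Ω′`, for ANY coarse weight `ω > 0` and fine weight `w′ ≥ 0` with `ω ≤ w′` on every window:
(A′) weighted interior Hessian `Σ_μ Σ_{x∈Ω′} w′(x)|(∂′ᴴ_μ∂′_μ v_w)(x)|² ≤ α′‖w‖²`; (B) inverse-weighted energy `Σ_μ Σ_y ω(y)⁻¹|(∂_μ u_f)(y)|² ≤ β‖f‖²`;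
(Φ′) exterior density `Σ_μ Σ_{x∉Ω′}|(∂′ᴴ_μ∂′_μ v_w)(x)|² ≤ φ′‖w‖²`; (Φ) boundary differences `Σ_μ nsq(bdryPart (∂_μ u_f)) ≤ φ‖f‖²`.  THEN
`‖(D′^{Ω′})⁻¹·J^Ω − J^Ω·(D^Ω)⁻¹‖ ≤ (2/N)·(√α′·√β + √φ′·√φ)`.
(M-C `form_defect` + §3.)  EXPECTED SIZES for `ω, w′ =` distance to the re-entrant codimension-2 set of a union of unit blocks, floored at the
lattice scale: `α′, β = O(1)`, `φ′ = O(RN)`, `φ = O(1/N)` ⇒ rate `1/N`.  A SIBLING of socket (S2) of module M-S (v1.1 wording, referees ref1 R126 /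
ref2 R129-1): for `ω ≡ w′ ≡ 1` the binders (A′), (B) are summands of (S2)'s budgets while (Φ′), (Φ) stay displayed — no by-name
specialisation to `injected_le_of_budgets` is claimed. [folklore] -/
theorem injected_le_of_weighted (hN : 1 ≤ N) (ha' : 0 < a')
    {ω : Tor (fine N M) → ℝ} {w' : Tor (fine (R * N) M) → ℝ} (hω : ∀ y, 0 < ω y) (hw' : ∀ x, 0 ≤ w' x)
    (hcomp : ∀ (μ : Fin d) (y : Tor (fine N M)) (j : Fin d → Fin R), (j μ : ℕ) = 0 → ∀ n, n < 2 * R - 2 →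
      ω y ≤ w' (site N R M μ y j (n + 1)))
    {α' β φ' φ : ℝ} (hα' : 0 ≤ α') (hβ : 0 ≤ β) (hφ' : 0 ≤ φ') (hφ : 0 ≤ φ)
    (hA : ∀ w : {x // refineR N R M Ω x} → ℂ,
      ∑ μ, ∑ x ∈ univ.filter (refineR N R M Ω),
        w' x * ‖(Pdir (fine (R * N) M) ((R * N : ℕ) : ℂ) μ *ᵥ solExt (R * N) M a' (refineR N R M Ω) w) x‖ ^ 2 ≤ α' * nsq w)
    (hB : ∀ f : {y // Ω y} → ℂ,
      ∑ μ, ∑ y, (ω y)⁻¹ * ‖(sdiff (fine N M) (N : ℂ) μ *ᵥ solExt N M a' Ω f) y‖ ^ 2 ≤ β * nsq f)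
    (hE : ∀ w : {x // refineR N R M Ω x} → ℂ,
      ∑ μ, ∑ x ∈ univ.filter (fun x => ¬ refineR N R M Ω x),
        ‖(Pdir (fine (R * N) M) ((R * N : ℕ) : ℂ) μ *ᵥ solExt (R * N) M a' (refineR N R M Ω) w) x‖ ^ 2 ≤ φ' * nsq w)
    (hT : ∀ f : {y // Ω y} → ℂ,
      ∑ μ, nsq (bdryPart N M Ω μ (sdiff (fine N M) (N : ℂ) μ *ᵥ solExt N M a' Ω f)) ≤ φ * nsq f) :
    ‖(DOm (R * N) M a' (refineR N R M Ω))⁻¹ * JOm N R M Ω - JOm N R M Ω * (DOm N M a' Ω)⁻¹‖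
      ≤ 2 / (N : ℝ) * (Real.sqrt α' * Real.sqrt β + Real.sqrt φ' * Real.sqrt φ) := by
  have hNpos : (0 : ℝ) < N := by exact_mod_cast Nat.pos_of_ne_zero (NeZero.ne N)
  have hC : 0 ≤ 2 / (N : ℝ) * (Real.sqrt α' * Real.sqrt β + Real.sqrt φ' * Real.sqrt φ) := by positivity
  refine opNorm_le_of_pairing _ hC fun w f => ?_
  rw [form_defect N R M a' Ω ha' w f]
  set u := solExt N M a' Ω f with hu
  set v := solExt (R * N) M a' (refineR N R M Ω) w with hv
  have hu0 : ∀ y, ¬ Ω y → u y = 0 := fun y hy => solExt_apply_of_not N M a' _ f hy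
  refine (pairing_le_weighted N R M Ω hN hu0 v hω hw' hcomp).trans ?_
  have h1 := Real.sqrt_le_sqrt (hA w)
  have h2 := Real.sqrt_le_sqrt (hB f)
  have h3 := Real.sqrt_le_sqrt (hE w)
  have h4 := Real.sqrt_le_sqrt (hT f)
  rw [Real.sqrt_mul hα', ← hv] at h1
  rw [Real.sqrt_mul hβ, ← hu] at h2
  rw [Real.sqrt_mul hφ', ← hv] at h3
  rw [Real.sqrt_mul hφ, ← hu] at h4
  calc 2 / (N : ℝ) * (Real.sqrt (∑ μ, ∑ x ∈ univ.filter (refineR N R M Ω),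
            w' x * ‖(Pdir (fine (R * N) M) ((R * N : ℕ) : ℂ) μ *ᵥ v) x‖ ^ 2)
          * Real.sqrt (∑ μ, ∑ y, (ω y)⁻¹ * ‖(sdiff (fine N M) (N : ℂ) μ *ᵥ u) y‖ ^ 2)
        + Real.sqrt (∑ μ, ∑ x ∈ univ.filter (fun x => ¬ refineR N R M Ω x), ‖(Pdir (fine (R * N) M) ((R * N : ℕ) : ℂ) μ *ᵥ v) x‖ ^ 2)
          * Real.sqrt (∑ μ, nsq (bdryPart N M Ω μ (sdiff (fine N M) (N : ℂ) μ *ᵥ u))))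
      ≤ 2 / (N : ℝ) * ((Real.sqrt α' * Real.sqrt (nsq w)) * (Real.sqrt β * Real.sqrt (nsq f))
        + (Real.sqrt φ' * Real.sqrt (nsq w)) * (Real.sqrt φ * Real.sqrt (nsq f))) := by
        refine mul_le_mul_of_nonneg_left (add_le_add (mul_le_mul h1 h2 (Real.sqrt_nonneg _) (by positivity))
          (mul_le_mul h3 h4 (Real.sqrt_nonneg _) (by positivity))) (div_nonneg zero_le_two hNpos.le)
    _ = 2 / (N : ℝ) * (Real.sqrt α' * Real.sqrt β + Real.sqrt φ' * Real.sqrt φ) * Real.sqrt (nsq w) * Real.sqrt (nsq f) := by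
        ring

end Summit.QuantumFields.BalabanUV.Beta.GAN24.DirichletBoxWeightedSockets

end
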